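import Literature.MathematicalPhysics.QuantumFieldTheory.Balaban1983to89.T4ShellMeasureLevels
import Literature.MathematicalPhysics.QuantumFieldTheory.Balaban1983to89.T4ShellCount

/-!
# `T4Continuum.ShellMeasureBandCount` — road P2's BAND COUNT for row NE7c's root composition: the shell-measure END
`T4ShellMeasureLevels.shellWeightBound_of_levels` re-derived with the GEOMETRIC-RATE binder replaced by SUMMABILITY of
the two-run width, through the count road's band bookkeeping `T4ShellCount.bandMajorant` / `tsum_bandMajorant`, and the
slot-count binder `LiveWindow.count` PRODUCED from the cube count `T4ShellCount.CubeCount` (cell `pub-balaban`, rung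
(B)+1 cell `b2b-balaban-t4-*`; BINDER-OWNERS row NE7c, trigger `t4/T4-NE7c-TRIGGER.json` condition c6 — co-owner road
P2 «count × suppression», unit `b2b-balaban-t4-ne7c-p2` gen 23, attaches to the row's crew as a SUPPLIER; skeletons
`t4/skeletons/NE7c-t4-ne7c-p1.md` v0.3 seat S7/S9 and `t4/skeletons/NE7c-t4-ne7c-p2.md` v1.2 leaves L2/L3/S.7)

HONEST FRAMING (T4-DAG PAGE 1).  The cell's T4 target is rung (B)+1: existence AND uniqueness of the `ε → 0` limit of
Bałaban's unit-scale averaged loop expectations on a FIXED finite torus — NOT infinite volume, NOT a mass gap, NOT the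
Clay problem.  NE7c (`T4IndicatorShell.ShellWeightBound`, the single-run shell-weight bound of node U5b) is NOT PRINTED
in [Balaban 1983–89] (the manuscripts construct ONE run) and is NOT proved here or anywhere: this module is kernel
BOOKKEEPING between two hypothesis-shape ledgers of the cell — road P1's `LevelLedger` / `LiveWindow` (shell measure,
`T4ShellMeasureLevels`) and road P2's age ledger / band majorant / cube count (`T4ShellCount`) — so that the row's ONE
root composition (trigger seat S7) can consume either road's count BY NAME.  Nothing of Bałaban's is asserted; every
anti-concentration constant `D_j`, every width `ρ_j` and every slot count is a BINDER.  Spine estimates PROVED 0/9 before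
and after this file.  HONEST DEPENDENCY: continuum YM on T⁴ ⇐ BetaPertH ∧ nine spine estimates (0/9 proved); BetaPertH
⇐ (D1) ∧ (D4) ∧ CAP+tail; G-an2-4 gates asym, D1 and NE2/3/4.

WHAT IS PROVED ([folklore] finite-sum / `tsum` arithmetic, standard axioms, 0 `def`):
* §1 `shellWeightBound_of_slotLedger_summable` — P1's constructor `T4ShellMeasure.shellWeightBound_of_slotLedger` with
  the two geometric majorants `ω ≤ C·ϑ^K` replaced by ANY summable majorants: two slot ledgers + summable majorants ⇒
  `T4IndicatorShell.ShellWeightBound l₀ T A B shA shB (ω^A + ω^B)` LITERALLY.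
* §2 THE AGE-RESOLVED COUNT.  For a level ledger inside a live window of depth `N₁` (P1's (W1): `recent`, `le_top`),
  `ω K = Σ_{a ≤ N₁} ν_K(a) · D_{K−a} ρ_{K−a}` where `ν_K(a)` is the number of slots of AGE `a = K − lvl` (`omega_eq_sum_ages`);
  with an age-resolved count `ν_K(a) ≤ m a` (`a ≤ N₁`; road P2's `CubeCount` shape `m a = V·Λ^a`, one slot per cube of the
  age-`a` lattice per kind) and `D_j ≤ D̄`: `ω K ≤ bandMajorant N₁ m D̄ ρ K` (`omega_le_bandMajorant`) — road P2's band
  majorant of `T4ShellCount` §3, charged only on existing levels.  P1's uniform count `LiveWindow.count` (`ν̄`) IS an age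
  count with `m ≡ ν̄` (`ageCount_of_liveWindow`); conversely an age count bounded by `ν̄` gives `LiveWindow`
  (`liveWindow_of_ageCount`), and the cube count gives `ν̄ = V·Λ^{N₁}` (`ageBound_of_cubeCount`, `liveWindow_of_cubeCount`)
  — P1's binder «ν̄ — COUNTED not estimated, still a binder» (`T4ShellMeasureLevels` header) now has its count-road
  PRODUCER by name; the residual [dict] is the injection of level-`j` slots into (level-`j` cubes) × (finitely many kinds,
  census `t4/T4-XREAD-U5X15.md` §2), the same residual as leaf L2 of road P2's skeleton.
* §3 SUMMABILITY FROM `Summable ρ` ALONE and THE EXACT TOTAL: `summable_omega_of_band`, `tsum_omega_le_band`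
  (`Σ_K ω_K ≤ C₀(m, D̄) · Σ_j ρ_j`, `T4ShellCount.tsum_bandMajorant`: every level is live in exactly `N₁ + 1` consecutive
  comparisons, so the window entropy `C₀ = D̄·Σ_{a ≤ N₁} m a ≤ D̄·V·Σ_{a ≤ N₁} Λ^a` is paid ONCE — `C0_const_eq`,
  `C0_const_le_of_cubeCount`), versus the geometric route's `2(N₁+1)·ν̄·D̄·c₁·ϑ^{−N₁}·ϑ^K`.
* §4 THE END FOR THE CREW'S ROOT COMPOSITION: `shellWeightBound_of_levels_band` — two level ledgers [(R) + (M1) by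
  level, road P1's SM-L1…L6 through `slotAntiConcentration_of_levelData` etc.], two live windows [(W1)], `D ≤ D̄`, two
  age counts, `Summable ρ^A`, `Summable ρ^B` ⇒ `ShellWeightBound l₀ T A B shA shB (ω^A + ω^B)`; NO `ϑ`, NO rate constant;
  `tsum_wsh_le_band` the displayed total.  §5 recovers P1's END hypotheses as a special case: a rate `ρ_j ≤ c₁ϑ^j`,
  `0 ≤ ϑ < 1` makes a nonnegative width summable (`summable_width_of_rate`), and `LiveWindow.count` is an age count, so
  `shellWeightBound_of_levels_rate` has EXACTLY the binder list of `T4ShellMeasureLevels.shellWeightBound_of_levels`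
  minus `0 < ϑ` (only `0 ≤ ϑ` is used) and concludes the same `ShellWeightBound … (ω^A + ω^B)`; `tsum_wsh_le_rate`
  displays `Σ_K Wsh_K ≤ 2·(N₁+1)·ν̄·D̄·c₁·(1 − ϑ)⁻¹`.
* §6 non-vacuity: the one-slot toy of `T4ShellMeasureLevels.Toy` (top-level slot, `ρ_j = ϑ^j`) fires the band END with
  age count `m ≡ 1`, for `0 ≤ ϑ < 1` (kernel-checked `example`s).

WHICH END CONSUMES THIS (trigger c6).  Road P1's root composition S7 (`LevelLedger` ×2 → R): §4/§5 are drop-in heads with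
a weaker rate binder and the count binder produced; road P2's tier S (`ShellCountRoad.shellWeightBound_sharp_of_leaves`,
`T4ShellCount.shellWeightBound_of_ageLedger`) books the same band total `C₀ · Σ_j y_j` — ONE bookkeeping for both roads.
NOT here: any anti-concentration constant (road P1's (M1) binders SM-L1…L6), any rate (node U1b, `T4SupCloseLiaison` —
trigger c4), any slot census (NODE O).  Unit `b2b-balaban-t4-ne7c-p2` gen 23 (journal CLAIMS.log l.5261). [folklore]
-/

open Finset

namespace Summit.QuantumFields.BalabanUV.T4Continuum.ShellMeasureBandCount

open Literature.MathematicalPhysics.QuantumFieldTheory.Balaban1983to89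
open T4IndicatorShell T4ShellMeasure T4ShellMeasureLevels T4ShellCount

/-! ## §1 Two slot ledgers under SUMMABLE majorants ⇒ `ShellWeightBound` -/

section Summable

variable {ι σ σ' : Type*} {l₀ : ℝ} {T : ℕ → Finset ι} {A B shA shB : ℕ → ℝ → ι → ℝ}
  {SA : ℕ → Finset σ} {SB : ℕ → Finset σ'} {pieceA : ℕ → ℝ → σ → ι → ℝ} {pieceB : ℕ → ℝ → σ' → ι → ℝ}
  {cA : ℕ → σ → ℝ} {cB : ℕ → σ' → ℝ}

/-- **P1's constructor with summable (not geometric) majorants.**  Two per-run slot ledgers whose relative shell weights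
`ω^A`, `ω^B` lie under ANY summable majorants give `T4IndicatorShell.ShellWeightBound l₀ T A B shA shB (ω^A + ω^B)`
literally (cf. `T4ShellMeasure.shellWeightBound_of_slotLedger`, which asks `ω ≤ C·ϑ^K`). [folklore] -/
theorem shellWeightBound_of_slotLedger_summable (hA : SlotLedger l₀ T A shA SA pieceA cA)
    (hB : SlotLedger l₀ T B shB SB pieceB cB) {wA wB : ℕ → ℝ} (hωA : ∀ K, hA.omega K ≤ wA K)
    (hωB : ∀ K, hB.omega K ≤ wB K) (hwA : Summable wA) (hwB : Summable wB) :
    ShellWeightBound l₀ T A B shA shB (fun K => hA.omega K + hB.omega K) where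
  nonneg K := add_nonneg (hA.omega_nonneg K) (hB.omega_nonneg K)
  summable := (hwA.of_nonneg_of_le hA.omega_nonneg hωA).add (hwB.of_nonneg_of_le hB.omega_nonneg hωB)
  sh_nonneg_left := hA.sh_nonneg
  sh_le_left := hA.sh_le
  sh_nonneg_right := hB.sh_nonneg
  sh_le_right := hB.sh_le
  left K t ht := by
    have h := hA.sum_sh_le K ht
    have hZ := hA.sum_A_nonneg K ht
    nlinarith [hB.omega_nonneg K]
  right K t ht := by
    have h := hB.sum_sh_le K ht
    have hZ := hB.sum_A_nonneg K ht
    nlinarith [hA.omega_nonneg K]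

end Summable

/-! ## §2 The age-resolved count of a level ledger inside a live window -/

section AgeCount

variable {ι σ : Type*} {l₀ : ℝ} {T : ℕ → Finset ι} {A sh : ℕ → ℝ → ι → ℝ} {S : ℕ → Finset σ}
  {piece : ℕ → ℝ → σ → ι → ℝ} {lvl : ℕ → σ → ℕ} {D ρ : ℕ → ℝ} {N₁ : ℕ} {νbar : ℝ}

/-- Inside a live window, grouping the slots of comparison `K` by AGE `a = K − lvl K s ∈ [0, N₁]`:
`ω K = Σ_{a ≤ N₁} #{s : age s = a} · (D_{K−a} ρ_{K−a})`. [folklore] -/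
theorem omega_eq_sum_ages (h : LevelLedger l₀ T A sh S piece lvl D ρ) (hw : LiveWindow S lvl N₁ νbar) (K : ℕ) :
    h.toSlotLedger.omega K =
      ∑ a ∈ range (N₁ + 1), (((S K).filter fun s => K - lvl K s = a).card : ℝ) * (D (K - a) * ρ (K - a)) := by
  rw [h.omega_eq K]
  have hrew : ∑ s ∈ S K, D (lvl K s) * ρ (lvl K s) =
      ∑ s ∈ S K, (fun a => D (K - a) * ρ (K - a)) (K - lvl K s) := by
    refine sum_congr rfl fun s hs => ?_
    simp only [Nat.sub_sub_self (hw.le_top K s hs)]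
  rw [hrew]
  refine sum_slots_eq_sum_levels (S K) (range (N₁ + 1)) (fun s => K - lvl K s)
    (fun a => D (K - a) * ρ (K - a)) fun s hs => ?_
  rw [mem_range, Nat.lt_succ_iff]
  have := hw.recent K s hs
  omega

/-- No slot is older than the comparison: the age class `a > K` is empty. [folklore] -/
theorem card_age_eq_zero_of_lt {K a : ℕ} (hK : K < a) :
    ((S K).filter fun s => K - lvl K s = a).card = 0 := by
  rw [Finset.card_eq_zero, Finset.filter_eq_empty_iff]
  intro s _ h
  omega

/-- **ROAD P2's BAND MAJORANT BOUNDS ROAD P1's RELATIVE SHELL WEIGHT.**  Live window (W1) + an AGE-RESOLVED slot count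
`#{s ∈ S K : age s = a} ≤ m a` for `a ≤ N₁` (the cube-count shape: one slot per cube of the age-`a` lattice per kind) +
`D_j ≤ D̄` ⇒ `ω K ≤ bandMajorant N₁ m D̄ ρ K = Σ_{a ≤ N₁, a ≤ K} m a · D̄ · ρ (K − a)` (`T4ShellCount.bandMajorant`,
charged only on existing levels). [folklore] -/
theorem omega_le_bandMajorant (h : LevelLedger l₀ T A sh S piece lvl D ρ) (hw : LiveWindow S lvl N₁ νbar)
    {Dbar : ℝ} (hD : ∀ j, D j ≤ Dbar) {m : ℕ → ℝ}
    (hm : ∀ K, ∀ a ≤ N₁, (((S K).filter fun s => K - lvl K s = a).card : ℝ) ≤ m a) (K : ℕ) :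
    h.toSlotLedger.omega K ≤ bandMajorant N₁ m (fun _ => Dbar) ρ K := by
  rw [omega_eq_sum_ages h hw K]
  unfold bandMajorant
  refine sum_le_sum fun a ha => ?_
  have ha' : a ≤ N₁ := by simpa [mem_range, Nat.lt_succ_iff] using ha
  split_ifs with hK
  · have hcard := hm K a ha'
    have hDρ0 : 0 ≤ D (K - a) * ρ (K - a) := mul_nonneg (h.D_nonneg _) (h.ρ_nonneg _)
    have hm0 : 0 ≤ m a := (Nat.cast_nonneg _).trans hcard
    calc (((S K).filter fun s => K - lvl K s = a).card : ℝ) * (D (K - a) * ρ (K - a))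
        ≤ m a * (Dbar * ρ (K - a)) :=
          mul_le_mul hcard (mul_le_mul_of_nonneg_right (hD _) (h.ρ_nonneg _)) hDρ0 hm0
      _ = m a * Dbar * ρ (K - a) := by ring
  · rw [card_age_eq_zero_of_lt (S := S) (lvl := lvl) (not_le.1 hK), Nat.cast_zero, zero_mul]

/-- P1's uniform count IS an age count: under `LiveWindow S lvl N₁ ν̄`, every age class has at most `ν̄` slots.
[folklore] -/
theorem ageCount_of_liveWindow (hw : LiveWindow S lvl N₁ νbar) (K a : ℕ) :
    (((S K).filter fun s => K - lvl K s = a).card : ℝ) ≤ νbar := by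
  by_cases hK : a ≤ K
  · have hsub : ((S K).filter fun s => K - lvl K s = a) ⊆ ((S K).filter fun s => lvl K s = K - a) := by
      intro s hs
      rw [mem_filter] at hs ⊢
      refine ⟨hs.1, ?_⟩
      have := hw.le_top K s hs.1
      omega
    exact (Nat.cast_le.2 (card_le_card hsub)).trans (hw.count K (K - a))
  · rw [card_age_eq_zero_of_lt (S := S) (lvl := lvl) (not_le.1 hK), Nat.cast_zero]
    exact hw.νbar_nonneg

/-- Conversely, (W1) + an age count bounded by `ν̄` on the window IS P1's `LiveWindow S lvl N₁ ν̄`. [folklore] -/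
theorem liveWindow_of_ageCount (hrec : ∀ K, ∀ s ∈ S K, K ≤ lvl K s + N₁) (htop : ∀ K, ∀ s ∈ S K, lvl K s ≤ K)
    {m : ℕ → ℝ} (hm : ∀ K, ∀ a ≤ N₁, (((S K).filter fun s => K - lvl K s = a).card : ℝ) ≤ m a)
    (hν : ∀ a ≤ N₁, m a ≤ νbar) : LiveWindow S lvl N₁ νbar where
  recent := hrec
  le_top := htop
  count K j := by
    have hν0 : 0 ≤ νbar := ((Nat.cast_nonneg _).trans (hm 0 0 (Nat.zero_le _))).trans (hν 0 (Nat.zero_le _))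
    by_cases hj : K - N₁ ≤ j ∧ j ≤ K
    · have hsub : ((S K).filter fun s => lvl K s = j) ⊆ ((S K).filter fun s => K - lvl K s = K - j) := by
        intro s hs
        rw [mem_filter] at hs ⊢
        exact ⟨hs.1, by rw [hs.2]⟩
      have ha : K - j ≤ N₁ := by omega
      exact ((Nat.cast_le.2 (card_le_card hsub)).trans (hm K (K - j) ha)).trans (hν _ ha)
    · have h0 : ((S K).filter fun s => lvl K s = j).card = 0 := by
        rw [Finset.card_eq_zero, Finset.filter_eq_empty_iff]
        intro s hs hsj
        have h1 := hrec K s hs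
        have h2 := htop K s hs
        exact hj ⟨by omega, by omega⟩
      rw [h0, Nat.cast_zero]
      exact hν0

/-- ROAD P2's CUBE COUNT ⇒ P1's `ν̄`: `m a = V·Λ^a ≤ V·Λ^{N₁}` on the window (`Λ ≥ 1`, `V ≥ 0`). [folklore] -/
theorem ageBound_of_cubeCount {n : ℕ → ℕ} {V Λ : ℝ} (hc : CubeCount N₁ n V Λ) (hV : 0 ≤ V) (hΛ : 1 ≤ Λ) :
    ∀ a ≤ N₁, (n a : ℝ) ≤ V * Λ ^ N₁ := fun a ha =>
  (hc a ha).trans (mul_le_mul_of_nonneg_left (pow_le_pow_right₀ hΛ ha) hV)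

/-- … hence (W1) + slots counted by cubes ⇒ `LiveWindow S lvl N₁ (V·Λ^{N₁})` — P1's slot-count binder PRODUCED from road
P2's `CubeCount` (whose torus form is `ShellCountRoad.cubeCount_of_torus`); the residual [dict] is the injection of
slots into cubes × kinds. [folklore] -/
theorem liveWindow_of_cubeCount (hrec : ∀ K, ∀ s ∈ S K, K ≤ lvl K s + N₁) (htop : ∀ K, ∀ s ∈ S K, lvl K s ≤ K)
    {n : ℕ → ℕ} (hn : ∀ K, ∀ a ≤ N₁, ((S K).filter fun s => K - lvl K s = a).card ≤ n a)
    {V Λ : ℝ} (hc : CubeCount N₁ n V Λ) (hV : 0 ≤ V) (hΛ : 1 ≤ Λ) :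
    LiveWindow S lvl N₁ (V * Λ ^ N₁) :=
  liveWindow_of_ageCount hrec htop (m := fun a => (n a : ℝ)) (fun K a ha => Nat.cast_le.2 (hn K a ha))
    (ageBound_of_cubeCount hc hV hΛ)

end AgeCount

/-! ## §3 Summability from `Summable ρ` alone, and the exact band total -/

section Total

variable {ι σ : Type*} {l₀ : ℝ} {T : ℕ → Finset ι} {A sh : ℕ → ℝ → ι → ℝ} {S : ℕ → Finset σ}
  {piece : ℕ → ℝ → σ → ι → ℝ} {lvl : ℕ → σ → ℕ} {D ρ : ℕ → ℝ} {N₁ : ℕ} {νbar Dbar : ℝ} {m : ℕ → ℝ}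

/-- **`Summable ρ` ⇒ `Summable ω`** (no rate): the band majorant is summable for any summable level profile
(`T4ShellCount.summable_bandMajorant`). [folklore] -/
theorem summable_omega_of_band (h : LevelLedger l₀ T A sh S piece lvl D ρ) (hw : LiveWindow S lvl N₁ νbar)
    (hD : ∀ j, D j ≤ Dbar) (hm : ∀ K, ∀ a ≤ N₁, (((S K).filter fun s => K - lvl K s = a).card : ℝ) ≤ m a)
    (hρ : Summable ρ) : Summable h.toSlotLedger.omega :=
  (summable_bandMajorant (N := N₁) (m := m) (s := fun _ => Dbar) hρ).of_nonneg_of_le h.toSlotLedger.omega_nonneg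
    (omega_le_bandMajorant h hw hD hm)

/-- **THE EXACT BAND TOTAL**: `Σ_K ω_K ≤ C₀(m, D̄) · Σ_j ρ_j` (`T4ShellCount.tsum_bandMajorant`: Fubini on the band —
every level is live in exactly `N₁ + 1` consecutive comparisons). [folklore] -/
theorem tsum_omega_le_band (h : LevelLedger l₀ T A sh S piece lvl D ρ) (hw : LiveWindow S lvl N₁ νbar)
    (hD : ∀ j, D j ≤ Dbar) (hm : ∀ K, ∀ a ≤ N₁, (((S K).filter fun s => K - lvl K s = a).card : ℝ) ≤ m a)
    (hρ : Summable ρ) :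
    ∑' K, h.toSlotLedger.omega K ≤ C0 N₁ m (fun _ => Dbar) * ∑' j, ρ j := by
  rw [← tsum_bandMajorant (N := N₁) (m := m) (s := fun _ => Dbar) hρ]
  exact Summable.tsum_le_tsum (omega_le_bandMajorant h hw hD hm) (summable_omega_of_band h hw hD hm hρ)
    (summable_bandMajorant hρ)

/-- the band constant with a uniform `D̄`: `C₀(m, D̄) = D̄ · Σ_{a ≤ N₁} m a`. [folklore] -/
theorem C0_const_eq (N : ℕ) (m : ℕ → ℝ) (Dbar : ℝ) :
    C0 N m (fun _ => Dbar) = Dbar * ∑ a ∈ range (N + 1), m a := by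
  unfold C0
  rw [mul_sum]
  exact sum_congr rfl fun a _ => mul_comm _ _

/-- … and under the cube count `m a = n a ≤ V·Λ^a`: `C₀ ≤ D̄ · V · Σ_{a ≤ N₁} Λ^a` (window entropy paid ONCE).
[folklore] -/
theorem C0_const_le_of_cubeCount {N : ℕ} {n : ℕ → ℕ} {V Λ Dbar : ℝ} (hc : CubeCount N n V Λ) (hDbar : 0 ≤ Dbar) :
    C0 N (fun a => (n a : ℝ)) (fun _ => Dbar) ≤ Dbar * (V * ∑ a ∈ range (N + 1), Λ ^ a) := by
  rw [C0_const_eq, Finset.mul_sum (range (N + 1)) (fun a => Λ ^ a) V]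
  refine mul_le_mul_of_nonneg_left (sum_le_sum fun a ha => ?_) hDbar
  have ha' : a ≤ N := by simpa [mem_range, Nat.lt_succ_iff] using ha
  exact hc a ha'

/-- `P1`'s uniform count as the age count: `C₀(ν̄, D̄) = (N₁ + 1) · ν̄ · D̄`. [folklore] -/
theorem C0_uniform_eq (N : ℕ) (νbar Dbar : ℝ) :
    C0 N (fun _ => νbar) (fun _ => Dbar) = (N + 1) * νbar * Dbar := by
  unfold C0
  rw [sum_const, card_range, nsmul_eq_mul]
  push_cast
  ring

end Total

/-! ## §4 The END for the crew's root composition: two level ledgers + summable widths ⇒ `ShellWeightBound` -/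

section End

variable {ι σ σ' : Type*} {l₀ : ℝ} {T : ℕ → Finset ι} {A B shA shB : ℕ → ℝ → ι → ℝ}
  {SA : ℕ → Finset σ} {SB : ℕ → Finset σ'} {pieceA : ℕ → ℝ → σ → ι → ℝ} {pieceB : ℕ → ℝ → σ' → ι → ℝ}
  {lvlA : ℕ → σ → ℕ} {lvlB : ℕ → σ' → ℕ} {DA ρA DB ρB : ℕ → ℝ} {N₁ : ℕ} {νbar Dbar : ℝ} {m : ℕ → ℝ}

/-- **NE7c's SHAPE FROM TWO LEVEL LEDGERS WITH SUMMABLE WIDTHS (band route; NO rate).**  The two runs of the `K`-th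
comparison as level ledgers [(R) + (M1) by level — road P1's binders], both inside a live window of depth `N₁` [(W1)],
constants `≤ D̄`, an age-resolved slot count `≤ m a` [road P2's cube-count shape], and SUMMABLE widths `ρ^A`, `ρ^B` ⇒
`T4IndicatorShell.ShellWeightBound l₀ T A B shA shB (ω^A + ω^B)`.  CONDITIONAL on its binders; nothing PRINTED is
asserted. [folklore] -/
theorem shellWeightBound_of_levels_band (hA : LevelLedger l₀ T A shA SA pieceA lvlA DA ρA)
    (hB : LevelLedger l₀ T B shB SB pieceB lvlB DB ρB)
    (hwA : LiveWindow SA lvlA N₁ νbar) (hwB : LiveWindow SB lvlB N₁ νbar)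
    (hDA : ∀ j, DA j ≤ Dbar) (hDB : ∀ j, DB j ≤ Dbar)
    (hmA : ∀ K, ∀ a ≤ N₁, (((SA K).filter fun s => K - lvlA K s = a).card : ℝ) ≤ m a)
    (hmB : ∀ K, ∀ a ≤ N₁, (((SB K).filter fun s => K - lvlB K s = a).card : ℝ) ≤ m a)
    (hρA : Summable ρA) (hρB : Summable ρB) :
    ShellWeightBound l₀ T A B shA shB (fun K => hA.toSlotLedger.omega K + hB.toSlotLedger.omega K) :=
  shellWeightBound_of_slotLedger_summable hA.toSlotLedger hB.toSlotLedger
    (omega_le_bandMajorant hA hwA hDA hmA) (omega_le_bandMajorant hB hwB hDB hmB)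
    (summable_bandMajorant hρA) (summable_bandMajorant hρB)

/-- … with the displayed total `Σ_K Wsh_K ≤ C₀(m, D̄) · (Σ_j ρ^A_j + Σ_j ρ^B_j)`. [folklore] -/
theorem tsum_wsh_le_band (hA : LevelLedger l₀ T A shA SA pieceA lvlA DA ρA)
    (hB : LevelLedger l₀ T B shB SB pieceB lvlB DB ρB)
    (hwA : LiveWindow SA lvlA N₁ νbar) (hwB : LiveWindow SB lvlB N₁ νbar)
    (hDA : ∀ j, DA j ≤ Dbar) (hDB : ∀ j, DB j ≤ Dbar)
    (hmA : ∀ K, ∀ a ≤ N₁, (((SA K).filter fun s => K - lvlA K s = a).card : ℝ) ≤ m a)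
    (hmB : ∀ K, ∀ a ≤ N₁, (((SB K).filter fun s => K - lvlB K s = a).card : ℝ) ≤ m a)
    (hρA : Summable ρA) (hρB : Summable ρB) :
    ∑' K, (hA.toSlotLedger.omega K + hB.toSlotLedger.omega K) ≤
      C0 N₁ m (fun _ => Dbar) * (∑' j, ρA j + ∑' j, ρB j) := by
  rw [(summable_omega_of_band hA hwA hDA hmA hρA).tsum_add (summable_omega_of_band hB hwB hDB hmB hρB), mul_add]
  exact add_le_add (tsum_omega_le_band hA hwA hDA hmA hρA) (tsum_omega_le_band hB hwB hDB hmB hρB)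

end End

/-! ## §5 P1's END recovered: a geometric rate is one summable width, `LiveWindow.count` is one age count -/

section Rate

variable {ι σ σ' : Type*} {l₀ : ℝ} {T : ℕ → Finset ι} {A B shA shB : ℕ → ℝ → ι → ℝ}
  {SA : ℕ → Finset σ} {SB : ℕ → Finset σ'} {pieceA : ℕ → ℝ → σ → ι → ℝ} {pieceB : ℕ → ℝ → σ' → ι → ℝ}
  {lvlA : ℕ → σ → ℕ} {lvlB : ℕ → σ' → ℕ} {DA ρA DB ρB : ℕ → ℝ} {N₁ : ℕ} {νbar Dbar c₁ ϑ : ℝ}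

/-- a nonnegative width under a rate `ρ_j ≤ c₁ϑ^j`, `0 ≤ ϑ < 1`, is summable with `Σ_j ρ_j ≤ c₁(1 − ϑ)⁻¹`. [folklore] -/
theorem summable_width_of_rate {ρ : ℕ → ℝ} (hρ0 : ∀ j, 0 ≤ ρ j) (hrate : ∀ j, ρ j ≤ c₁ * ϑ ^ j) (hϑ0 : 0 ≤ ϑ)
    (hϑ1 : ϑ < 1) : Summable ρ ∧ ∑' j, ρ j ≤ c₁ * (1 - ϑ)⁻¹ := by
  have hg : Summable fun j => c₁ * ϑ ^ j := (summable_geometric_of_lt_one hϑ0 hϑ1).mul_left c₁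
  refine ⟨hg.of_nonneg_of_le hρ0 hrate, ?_⟩
  calc ∑' j, ρ j ≤ ∑' j, c₁ * ϑ ^ j := Summable.tsum_le_tsum hrate (hg.of_nonneg_of_le hρ0 hrate) hg
    _ = c₁ * (1 - ϑ)⁻¹ := by rw [tsum_mul_left, tsum_geometric_of_lt_one hϑ0 hϑ1]

/-- **P1's END `T4ShellMeasureLevels.shellWeightBound_of_levels` THROUGH THE BAND** — the same binder list minus
`0 < ϑ` (only `0 ≤ ϑ` is used), the same conclusion `ShellWeightBound … (ω^A + ω^B)`: the geometric rate is ONE summable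
width and the uniform count `ν̄` is ONE age count. [folklore] -/
theorem shellWeightBound_of_levels_rate (hA : LevelLedger l₀ T A shA SA pieceA lvlA DA ρA)
    (hB : LevelLedger l₀ T B shB SB pieceB lvlB DB ρB)
    (hwA : LiveWindow SA lvlA N₁ νbar) (hwB : LiveWindow SB lvlB N₁ νbar) (hϑ0 : 0 ≤ ϑ) (hϑ1 : ϑ < 1)
    (hDA : ∀ j, DA j ≤ Dbar) (hDB : ∀ j, DB j ≤ Dbar)
    (hrateA : ∀ j, ρA j ≤ c₁ * ϑ ^ j) (hrateB : ∀ j, ρB j ≤ c₁ * ϑ ^ j) :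
    ShellWeightBound l₀ T A B shA shB (fun K => hA.toSlotLedger.omega K + hB.toSlotLedger.omega K) :=
  shellWeightBound_of_levels_band hA hB hwA hwB hDA hDB (m := fun _ => νbar)
    (fun K a _ => ageCount_of_liveWindow hwA K a) (fun K a _ => ageCount_of_liveWindow hwB K a)
    (summable_width_of_rate hA.ρ_nonneg hrateA hϑ0 hϑ1).1 (summable_width_of_rate hB.ρ_nonneg hrateB hϑ0 hϑ1).1

/-- … with the band total in P1's constants: `Σ_K Wsh_K ≤ (N₁+1)·ν̄·D̄ · 2c₁(1 − ϑ)⁻¹` — no `ϑ^{−N₁}`. [folklore] -/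
theorem tsum_wsh_le_rate (hA : LevelLedger l₀ T A shA SA pieceA lvlA DA ρA)
    (hB : LevelLedger l₀ T B shB SB pieceB lvlB DB ρB)
    (hwA : LiveWindow SA lvlA N₁ νbar) (hwB : LiveWindow SB lvlB N₁ νbar) (hϑ0 : 0 ≤ ϑ) (hϑ1 : ϑ < 1)
    (hDA : ∀ j, DA j ≤ Dbar) (hDB : ∀ j, DB j ≤ Dbar)
    (hrateA : ∀ j, ρA j ≤ c₁ * ϑ ^ j) (hrateB : ∀ j, ρB j ≤ c₁ * ϑ ^ j) :
    ∑' K, (hA.toSlotLedger.omega K + hB.toSlotLedger.omega K) ≤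
      (N₁ + 1) * νbar * Dbar * (2 * (c₁ * (1 - ϑ)⁻¹)) := by
  have hmA : ∀ K, ∀ a ≤ N₁, (((SA K).filter fun s => K - lvlA K s = a).card : ℝ) ≤ (fun _ => νbar) a :=
    fun K a _ => ageCount_of_liveWindow hwA K a
  have hmB : ∀ K, ∀ a ≤ N₁, (((SB K).filter fun s => K - lvlB K s = a).card : ℝ) ≤ (fun _ => νbar) a :=
    fun K a _ => ageCount_of_liveWindow hwB K a
  obtain ⟨hsA, htA⟩ := summable_width_of_rate hA.ρ_nonneg hrateA hϑ0 hϑ1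
  obtain ⟨hsB, htB⟩ := summable_width_of_rate hB.ρ_nonneg hrateB hϑ0 hϑ1
  have hC0 : 0 ≤ C0 N₁ (fun _ => νbar) (fun _ => Dbar) := by
    rw [C0_uniform_eq]
    have h1 : (0 : ℝ) ≤ N₁ + 1 := by positivity
    exact mul_nonneg (mul_nonneg h1 hwA.νbar_nonneg) (hA.const_bound_nonneg hDA)
  calc ∑' K, (hA.toSlotLedger.omega K + hB.toSlotLedger.omega K)
      ≤ C0 N₁ (fun _ => νbar) (fun _ => Dbar) * (∑' j, ρA j + ∑' j, ρB j) :=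
        tsum_wsh_le_band hA hB hwA hwB hDA hDB hmA hmB hsA hsB
    _ ≤ C0 N₁ (fun _ => νbar) (fun _ => Dbar) * (c₁ * (1 - ϑ)⁻¹ + c₁ * (1 - ϑ)⁻¹) :=
        mul_le_mul_of_nonneg_left (add_le_add htA htB) hC0
    _ = (N₁ + 1) * νbar * Dbar * (2 * (c₁ * (1 - ϑ)⁻¹)) := by rw [C0_uniform_eq]; ring

end Rate

/-! ## §6 Non-vacuity: the one-slot toy of `T4ShellMeasureLevels.Toy` through the band END -/

section Sanity

open T4ShellMeasureLevels.Toy in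
/-- SANITY: the top-level one-slot toy (`ρ_j = ϑ^j`, `D ≡ 1`, window depth `0`) has age count `m ≡ 1` and a summable
width for `0 ≤ ϑ < 1`, so the band END fires and delivers `ShellWeightBound` with `Wsh K = ϑ^K + ϑ^K`; kernel-checked,
honest scope (the content of NE7c is in the binders). [folklore] -/
example (l₀ ϑ : ℝ) (h0 : 0 ≤ ϑ) (h1 : ϑ < 1) :
    ShellWeightBound l₀ T A A (sh ϑ) (sh ϑ)
      (fun K => (levelLedger l₀ h0 h1.le).toSlotLedger.omega K +
        (levelLedger l₀ h0 h1.le).toSlotLedger.omega K) :=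
  shellWeightBound_of_levels_band (N₁ := 0) (νbar := 1) (Dbar := 1) (m := fun _ => 1)
    (levelLedger l₀ h0 h1.le) (levelLedger l₀ h0 h1.le) liveWindow liveWindow (fun _ => le_rfl) (fun _ => le_rfl)
    (fun K a _ => ageCount_of_liveWindow liveWindow K a) (fun K a _ => ageCount_of_liveWindow liveWindow K a)
    (summable_geometric_of_lt_one h0 h1) (summable_geometric_of_lt_one h0 h1)

open T4ShellMeasureLevels.Toy in
/-- SANITY: on the toy the band total reads `Σ_K (ϑ^K + ϑ^K) ≤ C₀(1, 1)·(2(1 − ϑ)⁻¹)` with `C₀(1,1) = 1`. [folklore] -/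
example (l₀ ϑ : ℝ) (h0 : 0 ≤ ϑ) (h1 : ϑ < 1) :
    ∑' K, ((levelLedger l₀ h0 h1.le).toSlotLedger.omega K + (levelLedger l₀ h0 h1.le).toSlotLedger.omega K) ≤
      C0 0 (fun _ => (1 : ℝ)) (fun _ => 1) * (∑' j, ρ ϑ j + ∑' j, ρ ϑ j) :=
  tsum_wsh_le_band (N₁ := 0) (νbar := 1) (Dbar := 1) (m := fun _ => 1)
    (levelLedger l₀ h0 h1.le) (levelLedger l₀ h0 h1.le) liveWindow liveWindow (fun _ => le_rfl) (fun _ => le_rfl)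
    (fun K a _ => ageCount_of_liveWindow liveWindow K a) (fun K a _ => ageCount_of_liveWindow liveWindow K a)
    (summable_geometric_of_lt_one h0 h1) (summable_geometric_of_lt_one h0 h1)

end Sanity

end Summit.QuantumFields.BalabanUV.T4Continuum.ShellMeasureBandCount
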